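/-
COR-CM (cells pub-hodgecm / pub-hodgecm2, stage 2 of the Hodge ladder) — TRANSPOSITION item (vi), S-LANE «BUILT-EPI-D1»: the END display of record
(✔ p328154 `…RestOneBuiltEpi.lean`, 4 NAMED {h; hLiu; h21; hirr} + hM) RE-DERIVED with the READING `hirr` ([Liu2021] Def. 4.11 «irreducible», posited
at the display's constructed carriers) REPLACED BY CARRIERS-PLAN ROW 9's inputs: ONE application of p328154 §1∕§2 at
`hirr := fun F _ h6 Φ ι₁ hι₁ V i ↦ Model.hirr_of_lemD1AsPrinted_row9 F ι₁ V Φ i.1.1 i.1.2 (OmegaMuSplitting.muLocalSplittings …) (OmegaMuSplitting.hfac_sMu …)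
(localMu …) (norm_localMu …) (continuous_localMu …) (localMu_toLocalRing_eq_one_iff …) (hD1 …) (Def411WeilCarriers.survival …)` — own-htheta's X3-ω junction (✔ p329944) fed
with TREE TERMS: the μ-attached local splittings `𝓢 := OmegaMuSplitting.muLocalSplittings` (GR-2's `χ_μ`-normalised CM package of the doubled group,
`cmFinLocalFamily` ✔ p330529, UNDOUBLED place by place: pin-1 `FinLocalSplittings.undouble` ✔ p331090 ∘ GR-1 `undoubleLoc` ✔ p327932, read on the display's
Gram data), its local–global factorisation `hfac := OmegaMuSplitting.hfac_sMu` («undoubling commutes with place-assembly», own-htheta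
`GelbartRogawski1991/UndoublingPlaceAssembly` over pin-3 ✔ p330785 · pin-1 ✔ p331090 · hcomp-abcm-1 `DoubledWeilRepresentationUndoublingTensor`), and
[Liu2021, App. D Step 2]'s characters `μ_v := localMu (χ_μ) v` with their three printed properties PROVED (GR-1 ✔ `CMSplittingCharLocalMu`, bytes htheta-x2),
and Def. 4.11's `⊗'` survival clause `hS` DISCHARGED by the THEOREM `Def411WeilCarriers.survival` (item6-p3 `Liu2021/Def411WeilCarriersSurvival`: non-split places
`E_v¹` compact ✔ p328454, split places the (SPH) shift criterion — mc-theta-3 `LocalUnitarySplitPlaceDarboux` · own-crow `FinLocalSplittingsSplitSpherical(Darboux)` ·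
item6-p3 `Def411WeilCarriersSurvivalSplit` / `…IrreducibleOfSph`).
EFFECT ON THE DISPLAY: `hirr` GONE; ONE new displayed binder `hD1` — the per-place CITE [Liu2021, App. D Lemma D.1, first sentence + (1)] AS PRINTED at the
datum `localLemD1Data … v` (residual (ρ4)) ⇒ 4 NAMED {h; hLiu; h21; hD1} + hM, NO posited data.  Still ASSUMED: the published theorems `h`
[Deligne1979 2.1.2/2.2.5 record], `h21` [Shimura1998 Thm. 21.4], `hLiu` [Liu2021 Thm. 4.18 at the CONSTRUCTED system/objects/action], `hD1` [Liu2021 Lem. D.1 (1),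
per place], and the B01-O meeting binder `hM`.  Seat prover-pub-hodgecm2-pin-1-g8-0 (pin-1 gen 8), DRAFTING pen on own-htheta g6's word
(HOME/INBOX 14:50:05Z); FILING = the lead's candidate-#7 call under clause (i′) (T5 FRESH, landings of `UndoublingPlaceAssembly` ∕
`DoubledWeilRepresentationUndoublingTensor` ∕ `Item6MuLocalSplittings` ∕ `LocalUnitarySplitPlaceDarboux` ∕ `FinLocalSplittingsSplitSphericalDarboux` ∕
`Def411WeilCarriersSurvival` first).  Theorems only (two); no definition, no instance, no named fact, no `variable`;
nothing landed is edited or restated (NEW path, FILE-ONCE).  FRAMING: HC_CM is NOT proved; S2 = B01-S is NOT inhabited — the display is CONDITIONAL on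
published theorems entered as hypotheses and on hM; the socket `FaceThetaDataExists` stays uninhabited.
-/
import Summits.HodgeConjecture.CorCM.B01.Transposition.Item6SupplyPinnedAssemblyAlongHoldsRestOneBuiltEpi
import Summits.HodgeConjecture.CorCM.B01.Transposition.Item6HirrOfLemD1AsPrinted
import Summits.HodgeConjecture.CorCM.B01.Transposition.Item6MuLocalSplittings
import Literature.NumberTheory.GelbartRogawski1991.CMSplittingCharLocalMu
import Literature.NumberTheory.Automorphic.Liu2021.Def411WeilCarriersSurvival
import HarnessLib

set_option autoImplicit false

/-!
# B01-S and the (β)-free END display with the reading `hirr` replaced by Lemma D.1 (1) AS PRINTED, per place (BUILT-EPI-D1)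

§1 `Model.faceSupply_of_thm418AsPrinted_along_conj_holds_restOne_builtEpiD1` — BUILT-EPI §1 with `hirr` discharged by
`Model.hirr_of_lemD1AsPrinted_row9` at `𝓢 := OmegaMuSplitting.muLocalSplittings`, `hfac := OmegaMuSplitting.hfac_sMu`, `μ_v := localMu (χ_μ) v`,
`hS := Def411WeilCarriers.survival …`; ONE new binder `hD1`.
§2 `Model.hc_cm_of_thm418AsPrinted_along_conj_holds_restOne_builtEpiD1_meeting_rec` — meeting form on `U_rec`:
END DISPLAY 4 NAMED {h; hLiu; h21; hD1} + hM, NO posited data.  HC_CM is NOT proved.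

References as in `…RestOneBuiltEpi.lean` / `Item6HirrOfLemD1AsPrinted.lean` / `GelbartRogawski1991/CMSplittingCharLocalMu.lean` /
`Liu2021/Def411WeilCarriersSurvival.lean`.
-/

noncomputable section

open scoped TensorProduct InnerProductSpace Kronecker Matrix

namespace Summit.HodgeConjecture.CorCM.Model

open CategoryTheory CategoryTheory.Limits AlgebraicGeometry NumberField
open Literature.AlgebraicGeometry.Motives
open Literature.AlgebraicGeometry.HodgeTheory
open Literature.AlgebraicGeometry.ShimuraVarieties
open Literature.AlgebraicGeometry.ShimuraVarieties.UnitaryCanonicalModel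
open Literature.AlgebraicGeometry.ComplexMultiplication (IsCMTypeRealisation)
open Literature.NumberTheory.ComplexMultiplication
open Literature.NumberTheory.Automorphic
open Literature.NumberTheory.Automorphic.UnitaryGroup (localCharOfCenter)
open Literature.NumberTheory.Automorphic.IdeleClassGroup
open Literature.NumberTheory.Automorphic.PicardCM
open Literature.NumberTheory.Automorphic.Liu2021
open Literature.NumberTheory.Automorphic.Liu2021.AppendixC
open Literature.NumberTheory.Automorphic.Liu2021.AppendixC.RestOne
open Literature.NumberTheory.Automorphic.Liu2021.Def411WeilCarriers (JW TW isSymm_TW isUnit_det_TW JW_eq JW_apply_ne_zero lineOf)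
open Literature.NumberTheory.GelbartRogawski1991 Literature.NumberTheory.GelbartRogawski1991.UnitaryDualPair
open Literature.NumberTheory.GelbartRogawski1991.UnitaryDualPair.WeilCoinv
open Literature.NumberTheory.GelbartRogawski1991.UnitaryDualPair.LocalSplitting (localMu norm_localMu continuous_localMu localMu_toLocalRing_eq_one_iff)
open Literature.NumberTheory.Weil1964 Literature.RepresentationTheory
open Summit.HodgeConjecture.CorCM.Transposition

/-! ## §1  B01-S with EVERY carrier CONSTRUCTED, NO Albanese cite, `hirr` REPLACED by Lemma D.1 (1) per place, survival DISCHARGED -/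

/-- **B01-S from [Liu2021, Thm. 4.18] with every Liu carrier CONSTRUCTED, the Albanese cite RETIRED and Def. 4.11's «irreducible» DERIVED per place
from [Liu2021, App. D Lemma D.1 (1)] AS PRINTED** (`U = picardCMUniverse hHD hI h₁ h₃`): BUILT-EPI §1 (`…_restOne_builtEpi`), ONE APPLICATION, at
`hirr := fun F _ h6 Φ ι₁ hι₁ V i ↦ hirr_of_lemD1AsPrinted_row9 F ι₁ V Φ i.1.1 i.1.2 (muLocalSplittings …) (hfac_sMu …) (localMu (χ_μ)) (norm_localMu …)
(continuous_localMu …) (localMu_toLocalRing_eq_one_iff …) (hD1 …) (Def411WeilCarriers.survival …)`.  Displayed: the cites `h` ([Deligne1979] 2.1.2/2.2.5), `h21`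
([Shimura1998] Thm. 21.4), `hLiu` ([Liu2021] Thm. 4.18 at the constructed system/objects/action), `hD1` ([Liu2021] Lem. D.1 (1) AS PRINTED at `localLemD1Data … v`,
every finite `v`); NO data, NO Albanese cite, NO `hirr`, NO survival binder.  HC_CM is NOT proved; none of the hypotheses is inhabited here.
[cite: Liu2021, Thm. 4.18 (FJcycle.tex l. 2232–2245), Def. 4.11 (l. 2090–2096), App. D §D.1 Steps 1∕2∕3 (l. 5217∕5219∕5221), Lemma D.1 (l. 5227; (1) l. 5229)]
[cite: GelbartRogawski1991, §3.1 Prop. 3.1.1 p. 455 L1–3, Remark p. 457 L4–13] [cite: Shimura1998, §21.4 Thm. 21.4] [cite: Deligne1979ShimuraVarieties, §2.1.2, 2.2.5 and Cor. 2.7.21] -/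
theorem faceSupply_of_thm418AsPrinted_along_conj_holds_restOne_builtEpiD1
    (hHD : exists_isReal_hodgeModel) (hI : hodgePQ_independent_of_hodgeModel)
    (h₁ : BallQuotientUniformised) (h₃ : CMAbelianVarietyRealised)
    (h : exists_recordSystem)
    (hLiu : ∀ (F : CMField) [IsGalois ℚ F] (h6 : 6 ≤ Module.finrank ℚ F) (Φ : CMType F) (ι₁ : F →+* ℂ), ι₁ ∈ Φ.1 →
      ∀ V : HermSpace3 F ι₁, Thm418AsPrintedC (sec42DataOf h isoOf F ι₁ V Φ)
        (restOne (sec42DataOf h isoOf F ι₁ V Φ) (AlgHom.id ℚ F) ι₁ (isConjugateSymplectic_muOfInvType ι₁ Φ) (hasWeight_one_muOfInvType ι₁ Φ) (Def45.Carriers.ofPolDR (muOfInvType ι₁ Φ) (Def45.PolDR ι₁ (isConjugateSymplectic_muOfInvType ι₁ Φ) (Def45.RMuForm ι₁ (isConjugateSymplectic_muOfInvType ι₁ Φ))))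
            (Def411WeilCarriers.Eps ↥(maximalRealSubfield F) (imagUnitSq F)) (Def411WeilCarriers.epsOf ↥(maximalRealSubfield F) (imagUnitSq F) F (imagUnit F)) (Def411WeilCarriers.Chi ↥(maximalRealSubfield F) F (IsCMField.complexConj F))
            (Def411WeilCarriers.omega ↥(maximalRealSubfield F) F (IsCMField.complexConj F) 3 finProdFinEquiv (Matrix.diagonal V.diagEntries) (complexConj_imagUnit F) (imagUnit_ne_zero F) (imagUnit_mul_self F) (realDiagonal_isSymm F V.diagEntries V.complexConj_diagEntries) (isUnit_det_realDiagonal F V.diagEntries V.complexConj_diagEntries V.diagEntries_ne_zero) (realDiagonal_map F V.diagEntries V.complexConj_diagEntries).symm (OmegaMuSplitting.hsMu F ι₁ V Φ))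
            (Def411WeilCarriers.rho ↥(maximalRealSubfield F) F (IsCMField.complexConj F) 3 finProdFinEquiv (Matrix.diagonal V.diagEntries) (complexConj_imagUnit F) (imagUnit_ne_zero F) (imagUnit_mul_self F) (realDiagonal_isSymm F V.diagEntries V.complexConj_diagEntries) (isUnit_det_realDiagonal F V.diagEntries V.complexConj_diagEntries V.diagEntries_ne_zero) (realDiagonal_map F V.diagEntries V.complexConj_diagEntries).symm (OmegaMuSplitting.hsMu F ι₁ V Φ) V.adelicFinDiag.toMulEquiv.toMonoidHom) ((heckeTranslatesFamilyOf heckeTranslate_definedOver_holds h isoOf F ι₁ V Φ h6).rhoΩOne (AlgHom.id ℚ F) ι₁ (isConjugateSymplectic_muOfInvType ι₁ Φ) (hasWeight_one_muOfInvType ι₁ Φ) (Def45.Carriers.ofPolDR (muOfInvType ι₁ Φ) (Def45.PolDR ι₁ (isConjugateSymplectic_muOfInvType ι₁ Φ) (Def45.RMuForm ι₁ (isConjugateSymplectic_muOfInvType ι₁ Φ)))))))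
    (h21 : shimura1998_thm21_4_casselman)
    (hD1 : ∀ (F : CMField) [IsGalois ℚ F], 6 ≤ Module.finrank ℚ F → ∀ (Φ : CMType F) (ι₁ : F →+* ℂ), ι₁ ∈ Φ.1 →
      ∀ (V : HermSpace3 F ι₁) (ε : Def411WeilCarriers.Eps ↥(maximalRealSubfield F) (imagUnitSq F))
        (χ : Def411WeilCarriers.Chi ↥(maximalRealSubfield F) F (IsCMField.complexConj F)) (v : IsDedekindDomain.HeightOneSpectrum (𝓞 ↥(maximalRealSubfield F))),
        LemD1_1AsPrinted
          (Def411WeilCarriers.localLemD1Data ↥(maximalRealSubfield F) F (IsCMField.complexConj F) 3 finProdFinEquiv (Matrix.diagonal V.diagEntries)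
            (complexConj_imagUnit F) (imagUnit_ne_zero F) (imagUnit_mul_self F) (realDiagonal_isSymm F V.diagEntries V.complexConj_diagEntries)
            (isUnit_det_realDiagonal F V.diagEntries V.complexConj_diagEntries V.diagEntries_ne_zero)
            (realDiagonal_map F V.diagEntries V.complexConj_diagEntries).symm (lineOf ↥(maximalRealSubfield F) (imagUnitSq F) ε)
            (OmegaMuSplitting.muLocalSplittings F ι₁ V Φ (lineOf ↥(maximalRealSubfield F) (imagUnitSq F) ε))
            (le_of_eq (Nat.mul_one 3).symm) (localMu F (OmegaMuSplitting.chiMu F ι₁ Φ))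
            (fun v x => norm_localMu F (OmegaMuSplitting.chiMu F ι₁ Φ) v (OmegaMuSplitting.chiMu_isUnitary F ι₁ Φ) x)
            (continuous_localMu F (OmegaMuSplitting.chiMu F ι₁ Φ))
            (fun v t => localMu_toLocalRing_eq_one_iff F (OmegaMuSplitting.chiMu F ι₁ Φ) v (OmegaMuSplitting.chiMu_isSplittingChar F ι₁ Φ) t)
            χ.1
            (Def411WeilCarriers.norm_chi_eq_one ↥(maximalRealSubfield F) F (IsCMField.complexConj F)
              (Algebra.IsQuadraticExtension.finrank_eq_two ↥(maximalRealSubfield F) F)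
              (UnitaryGroup.algEquiv_ne_one_of_apply_eq_neg ↥(maximalRealSubfield F) F (IsCMField.complexConj F) (complexConj_imagUnit F)
                (imagUnit_ne_zero F)) χ)
            χ.2.1 v)) :
    (picardCMUniverse hHD hI h₁ h₃).FaceSupply :=
  -- ONE APPLICATION of BUILT-EPI §1 with the reading `hirr` DISCHARGED by own-htheta's row-9 junction at the display's carriers:
  -- DATA `𝓢 := muLocalSplittings` (GR-2's χ_μ-normalised CM package undoubled place by place: pin-1 `FinLocalSplittings.undouble` ∘ GR-1 `undoubleLoc`),
  -- `hfac := hfac_sMu` («undoubling commutes with place-assembly»), Step-2 characters `μ_v := localMu (χ_μ)` with their three properties (GR-1/x2).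
  faceSupply_of_thm418AsPrinted_along_conj_holds_restOne_builtEpi hHD hI h₁ h₃ h hLiu h21
    (fun F _ h6 Φ ι₁ hι₁ V i =>
      haveI : NeZero (3 * 1) := ⟨by decide⟩
      hirr_of_lemD1AsPrinted_row9 F ι₁ V Φ i.1.1 i.1.2 (OmegaMuSplitting.muLocalSplittings F ι₁ V Φ (lineOf ↥(maximalRealSubfield F) (imagUnitSq F) i.1.1))
        (OmegaMuSplitting.hfac_sMu F ι₁ V Φ (lineOf ↥(maximalRealSubfield F) (imagUnitSq F) i.1.1))
        (localMu F (OmegaMuSplitting.chiMu F ι₁ Φ))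
        (fun v x => norm_localMu F (OmegaMuSplitting.chiMu F ι₁ Φ) v (OmegaMuSplitting.chiMu_isUnitary F ι₁ Φ) x)
        (continuous_localMu F (OmegaMuSplitting.chiMu F ι₁ Φ))
        (fun v t => localMu_toLocalRing_eq_one_iff F (OmegaMuSplitting.chiMu F ι₁ Φ) v (OmegaMuSplitting.chiMu_isSplittingChar F ι₁ Φ) t)
        (hD1 F h6 Φ ι₁ hι₁ V i.1.1 i.1.2)
        -- Def. 4.11's `⊗'` survival clause DISCHARGED (item6-p3 `Def411WeilCarriers.survival`: non-split places `E_v¹` compact,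
        -- split places the (SPH) shift criterion — mc-theta-3 / own-crow / item6-p3), NOT displayed
        (Def411WeilCarriers.survival ↥(maximalRealSubfield F) F (IsCMField.complexConj F) 3 finProdFinEquiv (Matrix.diagonal V.diagEntries)
          (complexConj_imagUnit F) (imagUnit_ne_zero F) (imagUnit_mul_self F) (realDiagonal_isSymm F V.diagEntries V.complexConj_diagEntries)
          (isUnit_det_realDiagonal F V.diagEntries V.complexConj_diagEntries V.diagEntries_ne_zero)
          (realDiagonal_map F V.diagEntries V.complexConj_diagEntries).symm i.1.1 i.1.2
          (OmegaMuSplitting.muLocalSplittings F ι₁ V Φ (lineOf ↥(maximalRealSubfield F) (imagUnitSq F) i.1.1))))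

/-! ## §2  THE (β)-FREE END DISPLAY, MEETING FORM, on the universe of record — 4 NAMED {h; hLiu; h21; hD1} + hM, `hirr` GONE -/

section MeetingFormBuiltEpiD1

open MeasureTheory
open Prior.Perl34File (Perl34.IsolationSetting)
open Prior.Perl34File.Perl34

/-- **END DISPLAY, (β)-FREE MEETING FORM, on the universe OF RECORD, every Liu carrier CONSTRUCTED, NO Albanese cite, `hirr` REPLACED by Lemma D.1 (1) per
place** (`let U := U_rec`): §1 composed BY NAME with `hc_cm_of_supply_of_settingMeetSat_embOf` at the four `_holds` data and `deligneMilne1982_Thm_6_20_full_holds`,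
exactly as BUILT-EPI §2.  Displayed hypotheses = cites {`h`, `h21`, `hLiu`, `hD1` (per place)} · NO data + the theta-side meeting binder `hM`
(b01-x2's text VERBATIM at `U_rec`) = 4 NAMED + hM.  HC_CM is NOT proved: no hypothesis is inhabited here.
[cite: Liu2021, Thm. 4.18 (FJcycle.tex l. 2232–2245), Def. 4.11 (l. 2090–2096), App. D Lemma D.1 (l. 5227; (1) l. 5229)] [cite: Milne2005ShimuraVarieties, Thm. 13.6 p. 118]
[cite: Shimura1998, §21.4 Thm. 21.4] [cite: Deligne1979ShimuraVarieties, §2.1.2, 2.2.5 and Cor. 2.7.21] -/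
theorem hc_cm_of_thm418AsPrinted_along_conj_holds_restOne_builtEpiD1_meeting_rec
    (h : exists_recordSystem)
    (hLiu : ∀ (F : CMField) [IsGalois ℚ F] (h6 : 6 ≤ Module.finrank ℚ F) (Φ : CMType F) (ι₁ : F →+* ℂ), ι₁ ∈ Φ.1 →
      ∀ V : HermSpace3 F ι₁, Thm418AsPrintedC (sec42DataOf h isoOf F ι₁ V Φ)
        (restOne (sec42DataOf h isoOf F ι₁ V Φ) (AlgHom.id ℚ F) ι₁ (isConjugateSymplectic_muOfInvType ι₁ Φ) (hasWeight_one_muOfInvType ι₁ Φ) (Def45.Carriers.ofPolDR (muOfInvType ι₁ Φ) (Def45.PolDR ι₁ (isConjugateSymplectic_muOfInvType ι₁ Φ) (Def45.RMuForm ι₁ (isConjugateSymplectic_muOfInvType ι₁ Φ))))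
            (Def411WeilCarriers.Eps ↥(maximalRealSubfield F) (imagUnitSq F)) (Def411WeilCarriers.epsOf ↥(maximalRealSubfield F) (imagUnitSq F) F (imagUnit F)) (Def411WeilCarriers.Chi ↥(maximalRealSubfield F) F (IsCMField.complexConj F))
            (Def411WeilCarriers.omega ↥(maximalRealSubfield F) F (IsCMField.complexConj F) 3 finProdFinEquiv (Matrix.diagonal V.diagEntries) (complexConj_imagUnit F) (imagUnit_ne_zero F) (imagUnit_mul_self F) (realDiagonal_isSymm F V.diagEntries V.complexConj_diagEntries) (isUnit_det_realDiagonal F V.diagEntries V.complexConj_diagEntries V.diagEntries_ne_zero) (realDiagonal_map F V.diagEntries V.complexConj_diagEntries).symm (OmegaMuSplitting.hsMu F ι₁ V Φ))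
            (Def411WeilCarriers.rho ↥(maximalRealSubfield F) F (IsCMField.complexConj F) 3 finProdFinEquiv (Matrix.diagonal V.diagEntries) (complexConj_imagUnit F) (imagUnit_ne_zero F) (imagUnit_mul_self F) (realDiagonal_isSymm F V.diagEntries V.complexConj_diagEntries) (isUnit_det_realDiagonal F V.diagEntries V.complexConj_diagEntries V.diagEntries_ne_zero) (realDiagonal_map F V.diagEntries V.complexConj_diagEntries).symm (OmegaMuSplitting.hsMu F ι₁ V Φ) V.adelicFinDiag.toMulEquiv.toMonoidHom) ((heckeTranslatesFamilyOf heckeTranslate_definedOver_holds h isoOf F ι₁ V Φ h6).rhoΩOne (AlgHom.id ℚ F) ι₁ (isConjugateSymplectic_muOfInvType ι₁ Φ) (hasWeight_one_muOfInvType ι₁ Φ) (Def45.Carriers.ofPolDR (muOfInvType ι₁ Φ) (Def45.PolDR ι₁ (isConjugateSymplectic_muOfInvType ι₁ Φ) (Def45.RMuForm ι₁ (isConjugateSymplectic_muOfInvType ι₁ Φ)))))))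
    (h21 : shimura1998_thm21_4_casselman)
    (hD1 : ∀ (F : CMField) [IsGalois ℚ F], 6 ≤ Module.finrank ℚ F → ∀ (Φ : CMType F) (ι₁ : F →+* ℂ), ι₁ ∈ Φ.1 →
      ∀ (V : HermSpace3 F ι₁) (ε : Def411WeilCarriers.Eps ↥(maximalRealSubfield F) (imagUnitSq F))
        (χ : Def411WeilCarriers.Chi ↥(maximalRealSubfield F) F (IsCMField.complexConj F)) (v : IsDedekindDomain.HeightOneSpectrum (𝓞 ↥(maximalRealSubfield F))),
        LemD1_1AsPrinted
          (Def411WeilCarriers.localLemD1Data ↥(maximalRealSubfield F) F (IsCMField.complexConj F) 3 finProdFinEquiv (Matrix.diagonal V.diagEntries)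
            (complexConj_imagUnit F) (imagUnit_ne_zero F) (imagUnit_mul_self F) (realDiagonal_isSymm F V.diagEntries V.complexConj_diagEntries)
            (isUnit_det_realDiagonal F V.diagEntries V.complexConj_diagEntries V.diagEntries_ne_zero)
            (realDiagonal_map F V.diagEntries V.complexConj_diagEntries).symm (lineOf ↥(maximalRealSubfield F) (imagUnitSq F) ε)
            (OmegaMuSplitting.muLocalSplittings F ι₁ V Φ (lineOf ↥(maximalRealSubfield F) (imagUnitSq F) ε))
            (le_of_eq (Nat.mul_one 3).symm) (localMu F (OmegaMuSplitting.chiMu F ι₁ Φ))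
            (fun v x => norm_localMu F (OmegaMuSplitting.chiMu F ι₁ Φ) v (OmegaMuSplitting.chiMu_isUnitary F ι₁ Φ) x)
            (continuous_localMu F (OmegaMuSplitting.chiMu F ι₁ Φ))
            (fun v t => localMu_toLocalRing_eq_one_iff F (OmegaMuSplitting.chiMu F ι₁ Φ) v (OmegaMuSplitting.chiMu_isSplittingChar F ι₁ Φ) t)
            χ.1
            (Def411WeilCarriers.norm_chi_eq_one ↥(maximalRealSubfield F) F (IsCMField.complexConj F)
              (Algebra.IsQuadraticExtension.finrank_eq_two ↥(maximalRealSubfield F) F)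
              (UnitaryGroup.algEquiv_ne_one_of_apply_eq_neg ↥(maximalRealSubfield F) F (IsCMField.complexConj F) (complexConj_imagUnit F)
                (imagUnit_ne_zero F)) χ)
            χ.2.1 v)) :
    let U := picardCMUniverse exists_isReal_hodgeModel_holds hodgePQ_independent_of_hodgeModel_holds
      BallQuotient.ballQuotientUniformised_holds cmAbelianVarietyRealised_holds
    let hU := ballQuotientUniformisedDatum_of BallQuotient.ballQuotientUniformised_holds
    (∀ (F : CMField), IsGalois ℚ F → 6 ≤ Module.finrank ℚ F → ∀ (f : Face F) (ι₁ : F →+* ℂ), f.Admissible ι₁ →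
      ∀ V : HermSpace3 F ι₁,
      ∃ (H CG G SK SigIdx SigIdxG : Type) (_ : NormedAddCommGroup H) (_ : InnerProductSpace ℂ H) (_ : CompleteSpace H)
        (_ : NormedAddCommGroup CG) (_ : NormedSpace ℂ CG) (_ : Group G) (_ : TopologicalSpace G) (_ : TopologicalSpace SK)
        (S : Perl34.IsolationSetting H (Lp ℂ 2 V.autMeasure) CG G SK SigIdx SigIdxG),
        (∀ (Γ : Level V) (ω₁ ω₂ : U.CohC (U.pms F ι₁ V Γ) 1),
          ω₁ ∈ U.Uiso Γ F (f.psi 0) ι₁ → ω₂ ∈ U.Uiso Γ F (f.psi 1) ι₁ →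
            embOf exists_isReal_hodgeModel_holds hodgePQ_independent_of_hodgeModel_holds hU cmAbelianVarietyRealised_holds Γ
                (U.cup2C (U.pms F ι₁ V Γ) 1 ω₁ ω₂) ≠ 0 →
              ∃ u ∈ S.t12.S12,
                ⟪embOf exists_isReal_hodgeModel_holds hodgePQ_independent_of_hodgeModel_holds hU cmAbelianVarietyRealised_holds Γ
                    (U.cup2C (U.pms F ι₁ V Γ) 1 ω₁ ω₂), u⟫_ℂ ≠ 0) ∧
        (∀ χ : S.t34.X, S.t34.allowed χ → ∀ (Φ : SK) (Γ₁ : Level V)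
          (ω₁ ω₂ : U.CohC (U.pms F ι₁ V Γ₁) 1),
          ω₁ ∈ U.Uiso Γ₁ F (f.psi 0) ι₁ →
          ω₂ ∈ U.Uiso Γ₁ F (f.psi 1) ι₁ →
            ⟪embOf exists_isReal_hodgeModel_holds hodgePQ_independent_of_hodgeModel_holds hU cmAbelianVarietyRealised_holds Γ₁
                (U.cup2C (U.pms F ι₁ V Γ₁) 1 ω₁ ω₂),
              S.t34.ϑ χ Φ⟫_ℂ ≠ 0 →
              ∃ (Γ : Level V) (ω : Fin 4 → U.CohC (U.pms F ι₁ V Γ) 1),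
                (∀ i, ω i ∈ U.Uiso Γ F (f.psi i) ι₁) ∧
                  ⟪embOf exists_isReal_hodgeModel_holds hodgePQ_independent_of_hodgeModel_holds hU cmAbelianVarietyRealised_holds Γ
                      (U.cup2C (U.pms F ι₁ V Γ) 1 (ω 2) (ω 3)),
                    embOf exists_isReal_hodgeModel_holds hodgePQ_independent_of_hodgeModel_holds hU cmAbelianVarietyRealised_holds Γ
                      (U.cup2C (U.pms F ι₁ V Γ) 1 (ω 0) (ω 1))⟫_ℂ
                    ≠ 0)) →
    HC_CM :=
  fun hM ↦ hc_cm_of_supply_of_settingMeetSat_embOf exists_isReal_hodgeModel_holds hodgePQ_independent_of_hodgeModel_holds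
    BallQuotient.ballQuotientUniformised_holds cmAbelianVarietyRealised_holds deligneMilne1982_Thm_6_20_full_holds
    (faceSupply_of_thm418AsPrinted_along_conj_holds_restOne_builtEpiD1 _ _ _ _ h hLiu h21 hD1) hM

end MeetingFormBuiltEpiD1

end Summit.HodgeConjecture.CorCM.Model

end
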